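import Mathlib
import Literature.AlgebraicGeometry.Resolution.CobordantGame
import Summits.ResolutionOfSingularities.ResolutionOfSingularities.Theorems.WeightedInvariantLocalWeightedDropGradedSliceTwistedSuccessor
import Summits.ResolutionOfSingularities.ResolutionOfSingularities.Theorems.WeightedInvariantLocalWeightedDropGradedSliceTwistedSaturation
import Summits.ResolutionOfSingularities.ResolutionOfSingularities.Theorems.WeightedInvariantLocalWeightedDropGradedSliceWildRankZero
import Summits.ResolutionOfSingularities.ResolutionOfSingularities.Theorems.WeightedInvariantLocalWeightedDropGradedSliceWildSupport
import Summits.ResolutionOfSingularities.ResolutionOfSingularities.Theorems.WeightedInvariantLocalWeightedDropGradedGameCoordChangeInverse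

/-!
# `WeightedInvariant.LocalWeightedDrop`: the wild slice clause — **THE SAME-RANK TRANSFER HOLDS ALONG SATURATED PLAYS**
# (`SatWonBy`, the induction, and the theorem at the wild point)

Route `ResolutionOfSingularities/WeightedInvariant`, crux `LocalWeightedDrop` (stmt-ResolutionOfSingularities-8899).
[OURS · L1 W4.3] — res-type-060 (gen 10), WILD LIBRARY file 18; assembles files 16/17 (p530999 `…GradedSliceTwistedSuccessor`,
`…GradedSliceTwistedSaturation`) with res-type-099's conjugate-move machinery (p528590 `…GradedSliceWildConjMove`, p529199
`…GradedSliceWildOrbitSubst`, p529887 `…GradedSliceWildRankZero`) and res-type-060's wild trivialization p524471 / p525479 and transfers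
p512731 / p527298.  Nothing here is a statement of the manuscript under review on ladder RESOLUTION; not a verdict on ideator
res-L1-w43-idea-1's card A.  AI proof, weaker than expert review.

## The statement
The one-sided slice transfer T3″ «slice graded-won with rank α ⇒ successor graded-won with rank α» at a WILD frozen coordinate of
minimal valuation (res-type-060 WILD-SLICE-CLAUSE.md §0; tame half = p515424, rank-0 floor = res-type-099 p529887, general ranks
(W-min) OPEN) HOLDS whenever the slice's winning strategy is SATURATED for the twist: at every move `(θ, W)` one residue `m` with
`τⱼ ≡ m·Wⱼ (mod q)` on all blown-up coordinates, `τ` the twist exponents carried along the play (`τ = (1; −wⱼ)` at the wild point,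
then `(m; τⱼ − m·Wⱼ)` at each successor) — equivalently the twist group `μ_q` fixes every exceptional divisor of the play pointwise up to
the new torus (memo §9: exactly then the Kummer descent datum stays diagonal).

* `SatWonBy q α N L τ f` — graded-won with rank `< α` by saturated moves (definition by well-founded recursion, as `GradedWonBy`);
  `gradedWonBy_of_satWonBy` (forget), `satWonBy_one_of_gradedWonBy` (`q = 1`: every graded win is saturated — the tame case).
* **`gradedWonBy_twistedCyl_of_satWonBy`** — MAIN INDUCTION: if `h` is SAT-won with rank `< α` and `G` is a twisted cylinder over `h`,
  TC(G, h, τ, a): `G(x, y^q) = (1+y)ᵃ·h((1+y)^{τ}x)` with `τ` lifting the residues and `q ∣ τ·r` on the slice lattice, then `G` is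
  graded-won with rank `< α` for every lattice containing the cylinder lattice.  Step: conjugate `θ` through the twist (`conjMove`,
  `subst_frobFamily_subst_conjMove`, with `hdiv_of_graded`), pre-scale to exact saturation (`twistedCyl_upScale`,
  `exists_exact_saturation`), play `(id, (W,0))`, and at each singular successor `isSuccessorAt_of_twistedCyl` (the twisted structure
  REPRODUCES) + `dvd_tauDot_succLattice` + `cylLattice_succLattice_le` feed the induction hypothesis; transfers back by
  `gradedWonBy_subst_iff_of_graded`.
* `wildTau`, `dvd_wildTau_dot` — the exponents `(1; q⌈wⱼ/q⌉ − wⱼ)` of `Tw_q` (= the `ρ` of res-type-099's p532234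
  `subst_frobFamily_wildLambda_eq_scaleFam`, which supplies TC at the wild point) and the lattice congruence there (from res-type-099's
  `weight_functional_modEq_zero`).
* **`gradedWonBy_of_slice_wild_sat`** — T3″-SAT AT THE WILD POINT: under the repaired hypotheses (`c_v ≠ 0 < w_v`, `q = p^e ∣ w_v`,
  `(w_v/q : k) ≠ 0`, `q ∣ wⱼ` on the translated coordinates), a SAT-win of the slice with rank `< α` gives a graded win of the successor
  with rank `< α`.

What this does NOT say: that every graded win of a slice can be made saturated with the same rank — that is (W-min), open; off
saturation the successor structure is of translation type and its rank is governed by auxiliary germs (memo §9(d)).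
-/

set_option linter.dupNamespace false -- mandated namespace of this single-conjunct summit
set_option autoImplicit false

namespace Summit.ResolutionOfSingularities.ResolutionOfSingularities.Theorems

namespace GradedGame

open MvPowerSeries
open Literature.AlgebraicGeometry.Resolution
open Literature.AlgebraicGeometry.Resolution.FormalCoordChange (linMat)

variable {k : Type} [Field k]

/-! ## SAT-WON: the graded game with saturated weights, and the same-rank wild slice transfer along saturated plays -/

section SatGame

/-- **SAT-WON with rank `< α`** (twist modulus `q`, twist exponents `τ : Fin N → ZMod q` attached to the coordinates): the Prover
plays `L`-graded moves `(θ, w)` whose weights are SATURATED for the twist — one residue `m` with `τⱼ = m·wⱼ (mod q)` on every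
blown-up coordinate (the twist group `μ_q` fixes the exceptional divisor pointwise up to the new torus) — and every singular
successor at `c` is SAT-won with smaller rank for the propagated lattice `succLattice L w c` and the propagated exponents
`(m ; τⱼ − m·wⱼ)`.  Forgetting `τ` gives `GradedWonBy` (`gradedWonBy_of_satWonBy`); for `q = 1` the saturation is vacuous
(`satWonBy_one_of_gradedWonBy`). [OURS · L1 W4.3] -/
def SatWonBy (q : ℕ) : Ordinal.{0} → (N : ℕ) → AddSubgroup (Fin N → ℤ) → (Fin N → ZMod q) → MvPowerSeries (Fin N) k → Prop
  | α, N, L, τ, f => ∃ (θ : Fin N → MvPowerSeries (Fin N) k) (w : Fin N → ℕ) (m : ZMod q), IsLGradedMove L θ w ∧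
      (∀ j, 0 < w j → τ j = m * (w j : ZMod q)) ∧
      ∀ (c : Fin N → k) (a : ℕ) (g : MvPowerSeries (Fin (N + 1)) k), IsSuccessorAt f θ w c a g →
        ∃ (β : Ordinal.{0}) (_ : β < α),
          SatWonBy q β (N + 1) (succLattice L w c) (Fin.cons m fun j => τ j - m * (w j : ZMod q)) g
  termination_by α => α

/-- Unfolding of `SatWonBy`. [OURS · L1 W4.3] -/
theorem satWonBy_iff (q : ℕ) (α : Ordinal.{0}) {N : ℕ} (L : AddSubgroup (Fin N → ℤ)) (τ : Fin N → ZMod q)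
    (f : MvPowerSeries (Fin N) k) :
    SatWonBy q α N L τ f ↔ ∃ (θ : Fin N → MvPowerSeries (Fin N) k) (w : Fin N → ℕ) (m : ZMod q), IsLGradedMove L θ w ∧
      (∀ j, 0 < w j → τ j = m * (w j : ZMod q)) ∧
      ∀ (c : Fin N → k) (a : ℕ) (g : MvPowerSeries (Fin (N + 1)) k), IsSuccessorAt f θ w c a g →
        ∃ β, β < α ∧ SatWonBy q β (N + 1) (succLattice L w c) (Fin.cons m fun j => τ j - m * (w j : ZMod q)) g := by
  rw [SatWonBy]
  simp only [exists_prop]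

/-- SAT-wins are graded wins (forget the exponents). [OURS · L1 W4.3] -/
theorem gradedWonBy_of_satWonBy (q : ℕ) (α : Ordinal.{0}) :
    ∀ {N : ℕ} (L : AddSubgroup (Fin N → ℤ)) (τ : Fin N → ZMod q) (f : MvPowerSeries (Fin N) k),
      SatWonBy q α N L τ f → GradedWonBy α N L f := by
  induction α using WellFoundedLT.induction with
  | ind α ih =>
    intro N L τ f h
    rw [satWonBy_iff] at h
    obtain ⟨θ, w, m, hθ, -, hs⟩ := h
    rw [gradedWonBy_iff]
    refine ⟨θ, w, hθ, fun c a g hg => ?_⟩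
    obtain ⟨β, hβ, hW⟩ := hs c a g hg
    exact ⟨β, hβ, ih β hβ _ _ g hW⟩

/-- For the trivial twist (`q = 1`, the TAME case) every graded win is a SAT-win. [OURS · L1 W4.3] -/
theorem satWonBy_one_of_gradedWonBy (α : Ordinal.{0}) :
    ∀ {N : ℕ} (L : AddSubgroup (Fin N → ℤ)) (τ : Fin N → ZMod 1) (f : MvPowerSeries (Fin N) k),
      GradedWonBy α N L f → SatWonBy 1 α N L τ f := by
  induction α using WellFoundedLT.induction with
  | ind α ih =>
    intro N L τ f h
    rw [gradedWonBy_iff] at h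
    obtain ⟨θ, w, hθ, hs⟩ := h
    rw [satWonBy_iff]
    refine ⟨θ, w, 0, hθ, fun j _ => Subsingleton.elim _ _, fun c a g hg => ?_⟩
    obtain ⟨β, hβ, hW⟩ := hs c a g hg
    exact ⟨β, hβ, ih β hβ _ _ g hW⟩

/-- A successor of `f(θ)` under `(id, w)` is a successor of `f` under `(θ, w)`. [OURS · L1 W4.3] -/
theorem isSuccessorAt_of_subst {N : ℕ} (f : MvPowerSeries (Fin N) k) (θ : Fin N → MvPowerSeries (Fin N) k) (w : Fin N → ℕ)
    (c : Fin N → k) (a : ℕ) (g : MvPowerSeries (Fin (N + 1)) k) (h : IsSuccessorAt (subst θ f) X w c a g) :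
    IsSuccessorAt f θ w c a g := by
  have hX : subst (X : Fin N → MvPowerSeries (Fin N) k) (subst θ f) = subst θ f := by rw [subst_self]; rfl
  unfold IsSuccessorAt at h ⊢
  rwa [hX] at h

/-- Shifting the twist exponents by multiples of `q` keeps the lattice congruence. [OURS · L1 W4.3] -/
theorem dvd_tauDot_of_shift {N : ℕ} (q : ℕ) (τ τ' : Fin N → ℕ) (S : Fin N → ℕ) (hS : ∀ i, τ' i = τ i + q * S i)
    (r : Fin N → ℤ) (h : (q : ℤ) ∣ ∑ i, (τ i : ℤ) * r i) : (q : ℤ) ∣ ∑ i, (τ' i : ℤ) * r i := by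
  have : ∑ i, (τ' i : ℤ) * r i = ∑ i, (τ i : ℤ) * r i + (q : ℤ) * ∑ i, (S i : ℤ) * r i := by
    rw [Finset.mul_sum, ← Finset.sum_add_distrib]
    refine Finset.sum_congr rfl fun i _ => ?_
    rw [hS i]; push_cast; ring
  rw [this]
  exact dvd_add h (Dvd.intro _ rfl)

/-- The divisibility data of a graded coordinate change, for twist exponents satisfying the lattice congruence: with
`τ₂ = τ + q·R·𝟙`, `R = Σ τ`, every monomial `x^d` of `θᵢ` has `τᵢ ≤ τ₂·d` and `q ∣ τ₂·d − τᵢ` (the hypothesis `hdiv` of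
res-type-099's conjugation identity). [OURS · L1 W4.3] -/
theorem hdiv_of_graded {N : ℕ} (q : ℕ) (hq : 0 < q) (L : AddSubgroup (Fin N → ℤ)) (τ : Fin N → ℕ)
    (hL : ∀ r ∈ L, (q : ℤ) ∣ ∑ i, (τ i : ℤ) * r i) (θ : Fin N → MvPowerSeries (Fin N) k)
    (hθ0 : ∀ i, constantCoeff (θ i) = 0) (hgr : ∀ i d, coeff d (θ i) ≠ 0 → expVec d - Pi.single i 1 ∈ L) :
    ∀ i d, coeff d (θ i) ≠ 0 →
      τ i ≤ tauDeg (fun l => τ l + q * ∑ l', τ l') d ∧ q ∣ tauDeg (fun l => τ l + q * ∑ l', τ l') d - τ i := by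
  intro i d hd
  set R : ℕ := ∑ l', τ l' with hR
  have hd0 : d ≠ 0 := by
    rintro rfl
    exact hd (by rw [coeff_zero_eq_constantCoeff_apply]; exact hθ0 i)
  obtain ⟨i₀, hi₀⟩ : ∃ i₀, d i₀ ≠ 0 := by
    by_contra hcon; push Not at hcon; exact hd0 (Finsupp.ext hcon)
  have hτR : τ i ≤ R := Finset.single_le_sum (fun l _ => Nat.zero_le (τ l)) (Finset.mem_univ i)
  have hle : τ i ≤ tauDeg (fun l => τ l + q * R) d := by
    unfold tauDeg
    have h1 : τ i ≤ (τ i₀ + q * R) * d i₀ := by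
      have : 1 ≤ d i₀ := Nat.one_le_iff_ne_zero.mpr hi₀
      have hqR : R ≤ q * R := Nat.le_mul_of_pos_left R hq
      nlinarith
    exact h1.trans (Finset.single_le_sum (f := fun l => (τ l + q * R) * d l) (fun l _ => Nat.zero_le _) (Finset.mem_univ i₀))
  refine ⟨hle, ?_⟩
  -- divisibility in `ℤ`, then back to `ℕ`
  have hmem := hL _ (hgr i d hd)
  have hZ : (q : ℤ) ∣ ((tauDeg (fun l => τ l + q * R) d : ℕ) : ℤ) - (τ i : ℤ) := by
    have hsplit : ((tauDeg (fun l => τ l + q * R) d : ℕ) : ℤ) - (τ i : ℤ) =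
        (∑ l, (τ l : ℤ) * (expVec d - Pi.single i 1 : Fin N → ℤ) l) + (q : ℤ) * ∑ l, (R : ℤ) * (d l : ℤ) := by
      unfold tauDeg
      push_cast
      simp only [Pi.sub_apply, expVec, mul_sub, Finset.sum_sub_distrib, add_mul, Finset.sum_add_distrib, Finset.mul_sum]
      have hδ : ∑ l, (τ l : ℤ) * ((Pi.single i (1 : ℤ) : Fin N → ℤ) l) = τ i := by
        rw [Finset.sum_eq_single i]
        · simp
        · intro l _ hl; rw [Pi.single_eq_of_ne hl, mul_zero]
        · intro h; exact absurd (Finset.mem_univ _) h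
      rw [hδ]
      have : ∑ l, (q : ℤ) * (R : ℤ) * (d l : ℤ) = ∑ l, (q : ℤ) * ((R : ℤ) * (d l : ℤ)) :=
        Finset.sum_congr rfl fun l _ => by ring
      rw [this]
      ring
    rw [hsplit]
    exact dvd_add hmem (Dvd.intro _ rfl)
  rw [← Nat.cast_sub hle] at hZ
  exact Int.natCast_dvd_natCast.mp hZ

/-- **THE SAME-RANK WILD SLICE TRANSFER ALONG SATURATED PLAYS (main induction).**  If `h ∈ k[[x₀..x_n]]` is SAT-won with rank `< α`
for the lattice `L` and twist residues `τ̄`, and `G ∈ k[[x, y]]` is a twisted cylinder over `h`, TC(G, h, τ, a):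
`G(x, y^q) = (1+y)ᵃ · h((1+y)^{τᵢ} xᵢ)` with `τ ≡ τ̄ (mod q)` and `q ∣ τ·r` for every `r ∈ L`, then `G` is won with rank `< α`
in the graded game of every lattice `L' ⊇ cylLattice L`.  Induction on `α`: conjugate the slice's coordinate change through the
twist (res-type-099's `conjMove` / `subst_frobFamily_subst_conjMove`), pre-scale to exact saturation (`twistedCyl_upScale`,
`exists_exact_saturation`), play the weighted blow-up `(id, (W, 0))`, and at each singular successor use
`isSuccessorAt_of_twistedCyl` (the twisted structure reproduces) + `dvd_tauDot_succLattice` + `cylLattice_succLattice_le` to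
invoke the induction hypothesis. [OURS · L1 W4.3] -/
theorem gradedWonBy_twistedCyl_of_satWonBy (p e q : ℕ) [Fact p.Prime] [CharP k p] (hq : q = p ^ e) (α : Ordinal.{0}) :
    ∀ {n : ℕ} (L : AddSubgroup (Fin (n + 1) → ℤ)) (τz : Fin (n + 1) → ZMod q) (h : MvPowerSeries (Fin (n + 1)) k),
      SatWonBy q α (n + 1) L τz h →
      ∀ (τ : Fin (n + 1) → ℕ) (_ : ∀ i, ((τ i : ℕ) : ZMod q) = τz i) (_ : ∀ r ∈ L, (q : ℤ) ∣ ∑ i, (τ i : ℤ) * r i)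
        (a : ℕ) (L' : AddSubgroup (Fin (n + 1 + 1) → ℤ)) (_ : cylLattice L ≤ L') (G : MvPowerSeries (Fin (n + 1 + 1)) k)
        (_ : subst (frobFamily (k := k) n q) G = (1 + X (Fin.last (n + 1))) ^ a * subst (scaleFam (k := k) τ) h),
        GradedWonBy α (n + 1 + 1) L' G := by
  classical
  have hq0 : 0 < q := by rw [hq]; exact pow_pos (Nat.Prime.pos Fact.out) e
  haveI : NeZero q := ⟨hq0.ne'⟩
  induction α using WellFoundedLT.induction with
  | ind α ih =>
    intro n L τz h hsat τ hτ hL a L' hcyl G hTC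
    haveI : CharP (MvPowerSeries (Fin (n + 1 + 1)) k) p := charP_of_injective_ringHom MvPowerSeries.C_injective p
    have hfrob : ((1 : MvPowerSeries (Fin (n + 1 + 1)) k) + X (Fin.last (n + 1))) ^ q = 1 + X (Fin.last (n + 1)) ^ q := by
      rw [hq, add_pow_char_pow, one_pow]
    have hlast : (Pi.single (Fin.last (n + 1)) 1 : Fin (n + 1 + 1) → ℤ) ∈ L' := by
      refine hcyl ?_
      rw [mem_cylLattice_iff]
      have : (fun j : Fin (n + 1) => (Pi.single (Fin.last (n + 1)) (1 : ℤ) : Fin (n + 1 + 1) → ℤ) (Fin.castSucc j)) = 0 := by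
        funext j; simp [(Fin.castSucc_lt_last j).ne]
      rw [this]; exact L.zero_mem
    -- unfold the SAT-win of the slice
    rw [satWonBy_iff] at hsat
    obtain ⟨θ, W, m, ⟨⟨hθ0, hθdet, hWpos⟩, hθgr⟩, hsatW, hsucc⟩ := hsat
    -- (1) conjugate the coordinate change through the twist
    set R : ℕ := ∑ l', τ l' with hR
    set τ2 : Fin (n + 1) → ℕ := fun l => τ l + q * R with hτ2
    have hdiv := hdiv_of_graded q hq0 L τ hL θ hθ0 hθgr
    obtain ⟨u, hu1, hu0, hu⟩ := exists_inv_one_add_X (k := k) (Fin.last (n + 1))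
    have hTw : subst (frobFamily (k := k) n q) G = (1 + X (Fin.last (n + 1))) ^ a *
        subst (Fin.snoc (scaleFam (k := k) τ) (X (Fin.last (n + 1)))) (cylinder h) := by
      rw [hTC, subst_cylinder (hasSubst_snoc_scaleFam τ)]
      congr 2
      funext j
      rw [Fin.snoc_castSucc]
    have hTC2 := subst_frobFamily_subst_conjMove hq0 hfrob hu hu1 hdiv hθ0 G h a
      (Fin.snoc (scaleFam (k := k) τ) (X (Fin.last (n + 1)))) (constantCoeff_snoc_scaleFam τ) (snoc_scaleFam_castSucc τ) hTw
    set Θ := conjMove q τ τ2 u θ with hΘ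
    have hΘ0 : ∀ j, constantCoeff (Θ j) = 0 := constantCoeff_conjMove hθ0
    have hΘdet : IsUnit (linMat Θ).det := by
      change IsUnit (Matrix.of fun a b => coeff (Finsupp.single b 1) (Θ a)).det
      rw [hΘ, det_linMat_conjMove hu hu0]; exact hθdet
    have hΘgr := conjMove_graded hq0 hfrob hu hu1 hdiv L L' hcyl hlast hθgr
    -- (2) pre-scale to exact saturation
    have hτ2mod : ∀ j, 0 < W j → τ2 j ≡ m.val * W j [MOD q] := by
      intro j hw
      have h1 : ((τ2 j : ℕ) : ZMod q) = ((m.val * W j : ℕ) : ZMod q) := by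
        rw [hτ2]; push_cast
        rw [ZMod.natCast_self, zero_mul, add_zero, hτ j, hsatW j hw, ZMod.natCast_zmod_val]
      exact (ZMod.natCast_eq_natCast_iff _ _ _).mp h1
    obtain ⟨m', K, hm', hex, hdom⟩ := exists_exact_saturation q τ2 hq0 W (fun _ : Fin (n + 1 + 1) => (1 : k)) m.val
      (fun j _ hw => hτ2mod j hw)
    set τ3 : Fin (n + 1) → ℕ := τ2 + q • K with hτ3
    have hex3 : ∀ j, 0 < W j → τ3 j = m' * W j := fun j hw => hex j one_ne_zero hw
    set G3 := subst (Fin.snoc (scaleFam (k := k) K) (X (Fin.last (n + 1)))) (subst Θ G) with hG3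
    have hTC3 : subst (frobFamily (k := k) n q) G3 = (1 + X (Fin.last (n + 1))) ^ a * subst (scaleFam (k := k) τ3) (subst θ h) :=
      twistedCyl_upScale q τ2 a K hq0 hfrob (subst θ h) (subst Θ G) hTC2
    -- (3) the move `(id, (W, 0))` on `G3`, successors through the twisted-cylinder step
    have hG3won : GradedWonBy α (n + 1 + 1) L' G3 := by
      rw [gradedWonBy_iff]
      obtain ⟨i₀, hi₀⟩ := hWpos
      refine ⟨fun i => X i, Fin.snoc W 0, isLGradedMove_X L' _ ⟨Fin.castSucc i₀, by simpa using hi₀⟩, fun C A G₁ hS => ?_⟩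
      obtain ⟨h₁, hS₁, hTC₁⟩ := isSuccessorAt_of_twistedCyl q τ3 a W C m' hq0 (subst θ h) G3 hTC3
        (fun j _ hw => hex3 j hw) (fun j hw => (hex3 j hw).ge) A G₁ hS
      obtain ⟨β, hβ, hsat₁⟩ := hsucc _ A h₁ (isSuccessorAt_of_subst h θ W _ A h₁ hS₁)
      refine ⟨β, hβ, ?_⟩
      -- the induction hypothesis at the successor
      have hm'z : ((m' : ℕ) : ZMod q) = m := by
        rw [(ZMod.natCast_eq_natCast_iff _ _ _).mpr hm', ZMod.natCast_zmod_val]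
      have hτ3z : ∀ j, ((τ3 j : ℕ) : ZMod q) = τz j := by
        intro j
        rw [hτ3, Pi.add_apply, Pi.smul_apply, smul_eq_mul, hτ2]; push_cast
        rw [ZMod.natCast_self, zero_mul, zero_mul, add_zero, add_zero, hτ j]
      have hdom3 : ∀ j, m' * W j ≤ τ3 j := by
        intro j
        by_cases hw : 0 < W j
        · exact (hex3 j hw).ge
        · rw [Nat.eq_zero_of_not_pos hw, mul_zero]; exact Nat.zero_le _
      refine ih β hβ (succLattice L W fun l => C (Fin.castSucc l)) _ h₁ hsat₁ (succTau τ3 W m') ?_ ?_ (a + m' * A)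
        (succLattice L' (Fin.snoc W 0) C) ?_ G₁ hTC₁
      · intro i
        refine Fin.cases ?_ (fun j => ?_) i
        · rw [succTau_zero, Fin.cons_zero, hm'z]
        · rw [succTau_succ, Fin.cons_succ, Nat.cast_sub (hdom3 j)]; push_cast
          rw [hτ3z, hm'z]
      · have hL3 : ∀ r ∈ L, (q : ℤ) ∣ ∑ i, (τ3 i : ℤ) * r i := fun r hr =>
          dvd_tauDot_of_shift q τ τ3 (fun i => R + K i)
            (fun i => by rw [hτ3, Pi.add_apply, Pi.smul_apply, smul_eq_mul, hτ2]; ring) r (hL r hr)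
        exact dvd_tauDot_succLattice q τ3 W _ m' L hL3 (fun j _ hw => hex3 j hw) (fun j hw => (hex3 j hw).ge)
      · exact (cylLattice_succLattice_le L W C).trans (succLattice_mono hcyl _ _)
    -- (4) transfer back along the pre-scaling and the conjugate move
    have h2 : GradedWonBy α (n + 1 + 1) L' (subst Θ G) :=
      (gradedWonBy_subst_iff_of_graded α L' (subst Θ G) _ (constantCoeff_snoc_scaleFam K)
        (isUnit_det_linMat_snoc_scaleFam K) (snoc_scaleFam_graded K L' hlast)).mp hG3won
    exact (gradedWonBy_subst_iff_of_graded α L' G Θ hΘ0 hΘdet hΘgr).mp h2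

end SatGame

/-! ## The wild point: SAT-won slice ⇒ successor won, same rank -/

section WildPoint

variable {n : ℕ} (w : Fin (n + 1) → ℕ) (c : Fin (n + 1) → k) (q : ℕ)

/-- The twist exponents of the renormalised successor at a wild frozen coordinate `v` = last: `1` on the exceptional variable,
`resExp w q j = q⌈wⱼ/q⌉ − wⱼ` on `yⱼ` (the exponents of res-type-060's `Tw_q`, p524471). [OURS · L1 W4.3] -/
def wildTau : Fin (n + 1) → ℕ := Fin.cases 1 fun j => resExp w q (Fin.castSucc j)

/-- THE LATTICE CONGRUENCE AT THE WILD POINT: on the slice lattice of a point all of whose translated weights are multiples of `q`,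
`q ∣ wildTau · r` (from res-type-099's `weight_functional_modEq_zero` and `resExp ≡ −w`). [OURS · L1 W4.3] -/
theorem dvd_wildTau_dot (hq : 0 < q) (L : AddSubgroup (Fin (n + 1) → ℤ)) (hdvd : ∀ j, c j ≠ 0 → 0 < w j → q ∣ w j)
    (hv : q ∣ w (Fin.last n)) :
    ∀ r ∈ sliceLattice (succLattice L w c) (Fin.last n), (q : ℤ) ∣ ∑ i, (wildTau w q i : ℤ) * r i := by
  intro r hr
  rw [mem_sliceLattice_last_iff] at hr
  obtain ⟨v, hv', rfl⟩ := hr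
  have hz := weight_functional_modEq_zero w c q L hdvd v hv'
  refine (ZMod.intCast_zmod_eq_zero_iff_dvd _ q).mp ?_
  have hres : ∀ j : Fin (n + 1), ((resExp w q j : ℕ) : ZMod q) = -((w j : ℕ) : ZMod q) := by
    intro j
    have hr := resExp_add_eq w q hq j
    have : ((resExp w q j : ℕ) : ZMod q) + ((w j : ℕ) : ZMod q) = 0 := by
      rw [← Nat.cast_add, hr]; push_cast; rw [ZMod.natCast_self, zero_mul]
    linear_combination this
  have hwl : ((w (Fin.last n) : ℕ) : ZMod q) = 0 := (ZMod.natCast_eq_zero_iff _ _).mpr hv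
  push_cast
  rw [Fin.sum_univ_succ]
  simp only [wildTau, Fin.cases_zero, Fin.cases_succ, Nat.cast_one, one_mul, Fin.castSucc_zero]
  have step : ∀ j : Fin n, ((resExp w q (Fin.castSucc j) : ℕ) : ZMod q) * ((v (Fin.castSucc j.succ) : ℤ) : ZMod q) =
      -((((w (Fin.castSucc j) : ℕ) : ℤ) : ZMod q) * ((v (Fin.castSucc j).succ : ℤ) : ZMod q)) := by
    intro j; rw [hres, ← Fin.succ_castSucc, neg_mul]; push_cast; rfl
  rw [Finset.sum_congr rfl (fun j _ => step j), Finset.sum_neg_distrib, ← sub_eq_add_neg]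
  push_cast at hz ⊢
  rw [Fin.sum_univ_castSucc, hwl, zero_mul, add_zero] at hz
  exact hz

/-- **T3″ ALONG SATURATED PLAYS, AT THE WILD POINT.**  At a frozen coordinate `v` = last with `c_v ≠ 0 < w_v`, `q = p^e ∣ w_v`,
`(w_v/q : k) ≠ 0` and `q ∣ wⱼ` for every translated `j` (the repaired, minimal-valuation hypotheses of res-type-060's
WILD-SLICE-CLAUSE.md §0): if the slice `g|_{y_v=0}` is SAT-WON with rank `< α` for the slice lattice and the twist residues
`wildTau mod q` (`= (1; −wⱼ)`), then the successor `g` is won with rank `< α` in the graded game of the propagated lattice.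
`q = 1` recovers the tame theorem p515424 (`satWonBy_one_of_gradedWonBy`); res-type-099's p529887 is the rank-`0` floor without
the saturation side condition; the same-rank statement WITHOUT saturation (W-min) stays open. [OURS · L1 W4.3] -/
theorem gradedWonBy_of_slice_wild_sat (L : AddSubgroup (Fin (n + 1) → ℤ)) (F' : MvPowerSeries (Fin (n + 1)) k) (a : ℕ)
    (g : MvPowerSeries (Fin (n + 1 + 1)) k) (hfac : subst (CobordantGame.cruxChart k w c) F' = X 0 ^ a * g)
    (hc : c (Fin.last n) ≠ 0) (hw : 0 < w (Fin.last n)) (p e : ℕ) [Fact p.Prime] [CharP k p] (hq : q = p ^ e)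
    (hv : q ∣ w (Fin.last n)) (hE : ((w (Fin.last n) / q : ℕ) : k) ≠ 0) (hmin : ∀ j, j ≠ Fin.last n → c j ≠ 0 → q ∣ w j)
    (α : Ordinal.{0}) :
    SatWonBy q α (n + 1) (sliceLattice (succLattice L w c) (Fin.last n)) (fun i => ((wildTau w q i : ℕ) : ZMod q))
        (sliceGerm (Fin.last n) g) →
      GradedWonBy α (n + 1 + 1) (succLattice L w c) g := by
  classical
  intro hh
  haveI : CharP (MvPowerSeries (Fin (n + 1 + 1)) k) p := charP_of_injective_ringHom MvPowerSeries.C_injective p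
  have hq0 : 0 < q := by rw [hq]; exact pow_pos (Nat.Prime.pos Fact.out) e
  have hfrob : ((1 : MvPowerSeries (Fin (n + 1 + 1)) k) + X (Fin.last (n + 1))) ^ q = 1 + X (Fin.last (n + 1)) ^ q := by
    rw [hq, add_pow_char_pow, one_pow]
  set L' := succLattice L w c with hL'
  have hgen : ∀ j : Fin (n + 1), c j ≠ 0 → 0 < w j → (Pi.single j.succ 1 : Fin (n + 1 + 1) → ℤ) ∈ L' :=
    fun j hcj hwj => AddSubgroup.subset_closure (Or.inr ⟨j, hcj, hwj, rfl⟩)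
  have hlast : (Pi.single (Fin.last (n + 1)) 1 : Fin (n + 1 + 1) → ℤ) ∈ L' := by
    rw [← Fin.succ_last]; exact hgen _ hc hw
  have hdvd : ∀ j, c j ≠ 0 → 0 < w j → q ∣ w j := by
    intro j hcj hwj
    by_cases hj : j = Fin.last n
    · subst hj; exact hv
    · exact hmin j hj hcj
  -- the renormalised successor is a twisted cylinder over the slice
  set G := subst (wildLambda w c q) g with hG
  have hGcov : subst (frobFamily (k := k) n q) G =
      (1 + X (Fin.last (n + 1))) ^ a * subst (scaleFam (k := k) (wildTau w q)) (sliceGerm (Fin.last n) g) :=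
    subst_frobFamily_wildLambda_eq_scaleFam w c q hq0 hfrob hw hv hmin F' a g hfac
  have hGwon : GradedWonBy α (n + 1 + 1) L' G :=
    gradedWonBy_twistedCyl_of_satWonBy p e q hq α _ _ _ hh (wildTau w q) (fun _ => rfl)
      (dvd_wildTau_dot w c q hq0 L hdvd hv) a L' (cylLattice_sliceLattice_last_le L' hlast) G hGcov
  have hE' : ((ceilExp w q (Fin.last n) : ℕ) : k) ≠ 0 := by
    unfold ceilExp; rwa [ceilDiv_of_dvd _ _ hq0 hv]
  exact gradedWonBy_of_subst_wildLambda w c q α L' hlast hgen hc hE' g hGwon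

end WildPoint

end GradedGame

end Summit.ResolutionOfSingularities.ResolutionOfSingularities.Theorems
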